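import Summits.Ventures.YMGap.RobustBall.SecondSusceptibilityMajorantS
import HarnessLib

/-!
# Venture YMGap, track ROBUST-BALL (Y2) — TIER 2: THE SECOND-ORDER STATIC SUSCEPTIBILITY OF EVERY LOCAL OBSERVABLE AGAINST TWO DIRECTIONS OF THE
# BALL IS AN ABSOLUTELY CONVERGENT DOUBLE SERIES, UNIFORMLY ON THE WEIGHTED BALL

HONEST FRAMING. WHAT THIS IS: a venture file (cell `pub-ymgap`, track Y2 ROBUST-BALL, seat rb-p1, theorems only), the summation of the tree decay
of the third cumulant (`ThreePointDecayS`) over two directions `V`, `V'` of the ball, via the member-independent majorant of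
`SecondSusceptibilityMajorantS`.  Member `W ∈ MemBallZdS a Λ_t t` inside the one-link pair door (`t > 0`), ANY DLR state `μ`, local observable `F`
(on `Λ_F`, vector `δ_F`, bounded), directions `V`, `V'` with measurable bounded own-link terms and Frobenius-Lipschitz witnesses of total load
`≤ L`, `≤ L'` and of SIZE-WEIGHTED load `Σ'_{X∋e} #X·Σ_y lipV_X(y) ≤ L₂`, `≤ L₂'` through every link (finite-range / bounded-size directions have both):
* ★★ `sum_abs_threePoint_le_S` — for all finite families `T`, `T'` of link sets:
  `Σ_{X∈T} Σ_{Y∈T'} |u₃(F; V_X; V'_Y)| ≤ 768 N√N (Σδ_F)(#Λ_F C_s)(L L' #Λ_F C_s + L' L₂ C_s + L L₂' C_s)`, `C_s = d((1+e^{−(t/3)/d})/(1−e^{−(t/3)/d}))^d`;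
* ★★ `summable_abs_threePoint_direction_S` — `(X, Y) ↦ |u₃(F; V_X; V'_Y)|` is SUMMABLE OVER ALL PAIRS with the same bound on its sum: THE
  SECOND-ORDER RESPONSE COEFFICIENT OF EVERY LOCAL OBSERVABLE AGAINST EVERY PAIR OF DIRECTIONS IS FINITE, UNIFORMLY ON THE BALL;
* `su2_summable_abs_threePoint_direction_dim4` — `SU(2)`, `ℤ⁴`: `6|β_W| e^{a} e^{t} + e^{a/2} √(2/3) Λ < 1` ⇒ for Lipschitz cylinders
  `Σ' |u₃| ≤ 1536√2 (#Λ_F K_F)(#Λ_F C)(L L' #Λ_F C + L' L₂ C + L L₂' C)`, `C = 4((1+e^{−t/12})/(1−e^{−t/12}))⁴`.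
WHAT THIS IS NOT: the identification with a second derivative of the state (successor file); one-sided Dobrushin-comparison constants at lattice
strong coupling; nothing about the continuum limit or a Clay-sense mass gap.
-/

noncomputable section

open MeasureTheory Function Finset ProbabilityTheory Real
open scoped NNReal
open Literature.Probability.LatticeModels
open Literature.Probability.LatticeModels.DobrushinMetric
open Literature.MathematicalPhysics.QuantumLattice
open Literature.MathematicalPhysics.QuantumFieldTheory hiding ZdEdge
open Summit.QuantumFields.BalabanUV.InfraRed.StrongCouplingPoincareDoorSUN (oneLinkPoincareSUN_two_sharp)

namespace Summit.Ventures.YMGap.RobustBall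

variable {d N : ℕ}

section SUN

variable {W V V' : Potential (ZdEdge d) (Matrix.specialUnitaryGroup (Fin N) ℂ)}

/-- ★★ **PARTIAL SUMS OF THE SECOND-ORDER SUSCEPTIBILITY, uniformly on the weighted ball.**  Member `W ∈ MemBallZdS a Λ_t t` in the pair door
`ρ < 1` (`t ≥ 0`, here `t > 0`), ANY DLR `μ`; `F` measurable local (on `Λ_F`) bounded with Frobenius-Lipschitz vector `δ_F`; directions `V`, `V'`
(measurable bounded own-link terms) with Frobenius-Lipschitz witnesses of total loads `≤ L`, `≤ L'` and size-weighted loads `≤ L₂`, `≤ L₂'` through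
every link.  Then for all finite families `T`, `T'` of link sets:
`Σ_{X∈T} Σ_{Y∈T'} |u₃(F; V_X; V'_Y)| ≤ 768 N√N (Σδ_F) (#Λ_F C_s) (L L' #Λ_F C_s + L' L₂ C_s + L L₂' C_s)`, `C_s = d((1+e^{−(t/3)/d})/(1−e^{−(t/3)/d}))^d`. -/
theorem sum_abs_threePoint_le_S (hd : 1 ≤ d) (hN : 1 ≤ N) {β b c v a Λt t : ℝ}
    (hc : 0 ≤ c) (hv : 0 ≤ v) (hb : |β| * (2 * ((d : ℝ) - 1)) ≤ b)
    (hP : ∀ B : Matrix (Fin N) (Fin N) ℂ, matrixOpNorm B ≤ b →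
      ∀ (ψ : Matrix.specialUnitaryGroup (Fin N) ℂ → ℝ) (M : ℝ), 0 ≤ M →
        (∀ x y, |ψ x - ψ y| ≤ M * suFrobDist x y) →
        Var[ψ; (haarProbability (Matrix.specialUnitaryGroup (Fin N) ℂ)).tilted
          fun g => (N : ℝ) * ((g : Matrix (Fin N) (Fin N) ℂ) * B).trace.re] ≤ c * M ^ 2)
    (hVB : ∀ B : Matrix (Fin N) (Fin N) ℂ, matrixOpNorm B ≤ b → ∀ Δ : Matrix (Fin N) (Fin N) ℂ,
      Var[fun g : Matrix.specialUnitaryGroup (Fin N) ℂ =>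
          (N : ℝ) * ((g : Matrix (Fin N) (Fin N) ℂ) * Δ).trace.re;
        (haarProbability (Matrix.specialUnitaryGroup (Fin N) ℂ)).tilted
          fun g => (N : ℝ) * ((g : Matrix (Fin N) (Fin N) ℂ) * B).trace.re] ≤ v * frobNorm Δ ^ 2)
    (ht : 0 < t) (hρ : 6 * ((d : ℝ) - 1) * |β| * (exp a * exp t * Real.sqrt (c * v)) + exp (a / 2) * Real.sqrt c * Λt < 1)
    (hW : MemBallZdS a Λt t W) {μ : Measure (LGConfig d (Matrix.specialUnitaryGroup (Fin N) ℂ))}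
    (hμ : μ ∈ perturbedGibbsMeasuresS (d := d) (fundamentalRep (Fin N)) (N * β) W)
    {F : LGConfig d (Matrix.specialUnitaryGroup (Fin N) ℂ) → ℝ} (hFm : Measurable F) {ΛF : Finset (ZdEdge d)}
    (hFdep : DependsOn F (↑ΛF : Set (ZdEdge d))) {MF : ℝ} (hMF : ∀ σ, |F σ| ≤ MF) {δF : ZdEdge d → ℝ} (hδF : IsLipBound suFrobDist F δF)
    (hVm : ∀ X, Measurable (V X)) (hVdep : ∀ X, DependsOn (V X) (↑X : Set (ZdEdge d))) (hVb : ∀ X, ∃ C, ∀ U, |V X U| ≤ C)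
    {lipV : Finset (ZdEdge d) → ZdEdge d → ℝ} (hlipV : ∀ X, IsLipBound suFrobDist (V X) (lipV X)) {L L₂ : ℝ}
    (hLs : ∀ e, Summable fun X : Finset (ZdEdge d) => (if e ∈ X then ∑ y ∈ X, lipV X y else 0))
    (hL : ∀ e, ∑' X : Finset (ZdEdge d), (if e ∈ X then ∑ y ∈ X, lipV X y else 0) ≤ L)
    (hL2s : ∀ e, Summable fun X : Finset (ZdEdge d) => (if e ∈ X then X.card * ∑ y ∈ X, lipV X y else 0))
    (hL2 : ∀ e, ∑' X : Finset (ZdEdge d), (if e ∈ X then X.card * ∑ y ∈ X, lipV X y else 0) ≤ L₂)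
    (hV'm : ∀ X, Measurable (V' X)) (hV'dep : ∀ X, DependsOn (V' X) (↑X : Set (ZdEdge d))) (hV'b : ∀ X, ∃ C, ∀ U, |V' X U| ≤ C)
    {lipV' : Finset (ZdEdge d) → ZdEdge d → ℝ} (hlipV' : ∀ X, IsLipBound suFrobDist (V' X) (lipV' X)) {L' L₂' : ℝ}
    (hL's : ∀ e, Summable fun X : Finset (ZdEdge d) => (if e ∈ X then ∑ y ∈ X, lipV' X y else 0))
    (hL' : ∀ e, ∑' X : Finset (ZdEdge d), (if e ∈ X then ∑ y ∈ X, lipV' X y else 0) ≤ L')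
    (hL2's : ∀ e, Summable fun X : Finset (ZdEdge d) => (if e ∈ X then X.card * ∑ y ∈ X, lipV' X y else 0))
    (hL2' : ∀ e, ∑' X : Finset (ZdEdge d), (if e ∈ X then X.card * ∑ y ∈ X, lipV' X y else 0) ≤ L₂')
    (T T' : Finset (Finset (ZdEdge d))) :
    ∑ X ∈ T, ∑ Y ∈ T', |cov[fun σ => F σ * V X σ, V' Y; μ] - (∫ σ, F σ ∂μ) * cov[V X, V' Y; μ] - (∫ σ, V X σ ∂μ) * cov[F, V' Y; μ]| ≤
      768 * N * Real.sqrt N * (∑ y ∈ ΛF, δF y) *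
        (ΛF.card * (d * ((1 + exp (-(t / 3 / d))) / (1 - exp (-(t / 3 / d)))) ^ d)) *
        (L * L' * (ΛF.card * (d * ((1 + exp (-(t / 3 / d))) / (1 - exp (-(t / 3 / d)))) ^ d)) +
          L' * L₂ * (d * ((1 + exp (-(t / 3 / d))) / (1 - exp (-(t / 3 / d)))) ^ d) +
          L * L₂' * (d * ((1 + exp (-(t / 3 / d))) / (1 - exp (-(t / 3 / d)))) ^ d)) := by
  classical
  have hterm := fun X Y => abs_threePoint_le_majorant_S hd hN hc hv hb hP hVB ht hρ hW hμ hFm hFdep hMF hδF hVm hVdep hVb hlipV hV'm hV'dep hV'b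
    hlipV' rfl rfl rfl rfl rfl X Y
  have hsum := sum_majorant_le_S (N := N) (ΛF := ΛF) hd ht hδF.nonneg hlipV hLs hL hL2s hL2 hlipV' hL's hL' hL2's hL2' rfl rfl rfl rfl rfl rfl T T'
  exact (sum_le_sum fun X _ => sum_le_sum fun Y _ => hterm X Y).trans hsum

/-- ★★ **THE SECOND-ORDER SUSCEPTIBILITY IS AN ABSOLUTELY CONVERGENT DOUBLE SERIES, uniformly on the weighted ball.**  Under the hypotheses of
`sum_abs_threePoint_le_S`, the family `(X, Y) ↦ |u₃(F; V_X; V'_Y)|` is summable over ALL pairs of finite link sets and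
`Σ'_{(X,Y)} |u₃(F; V_X; V'_Y)| ≤ 768 N√N (Σδ_F) (#Λ_F C_s) (L L' #Λ_F C_s + L' L₂ C_s + L L₂' C_s)`. -/
theorem summable_abs_threePoint_direction_S (hd : 1 ≤ d) (hN : 1 ≤ N) {β b c v a Λt t : ℝ}
    (hc : 0 ≤ c) (hv : 0 ≤ v) (hb : |β| * (2 * ((d : ℝ) - 1)) ≤ b)
    (hP : ∀ B : Matrix (Fin N) (Fin N) ℂ, matrixOpNorm B ≤ b →
      ∀ (ψ : Matrix.specialUnitaryGroup (Fin N) ℂ → ℝ) (M : ℝ), 0 ≤ M →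
        (∀ x y, |ψ x - ψ y| ≤ M * suFrobDist x y) →
        Var[ψ; (haarProbability (Matrix.specialUnitaryGroup (Fin N) ℂ)).tilted
          fun g => (N : ℝ) * ((g : Matrix (Fin N) (Fin N) ℂ) * B).trace.re] ≤ c * M ^ 2)
    (hVB : ∀ B : Matrix (Fin N) (Fin N) ℂ, matrixOpNorm B ≤ b → ∀ Δ : Matrix (Fin N) (Fin N) ℂ,
      Var[fun g : Matrix.specialUnitaryGroup (Fin N) ℂ =>
          (N : ℝ) * ((g : Matrix (Fin N) (Fin N) ℂ) * Δ).trace.re;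
        (haarProbability (Matrix.specialUnitaryGroup (Fin N) ℂ)).tilted
          fun g => (N : ℝ) * ((g : Matrix (Fin N) (Fin N) ℂ) * B).trace.re] ≤ v * frobNorm Δ ^ 2)
    (ht : 0 < t) (hρ : 6 * ((d : ℝ) - 1) * |β| * (exp a * exp t * Real.sqrt (c * v)) + exp (a / 2) * Real.sqrt c * Λt < 1)
    (hW : MemBallZdS a Λt t W) {μ : Measure (LGConfig d (Matrix.specialUnitaryGroup (Fin N) ℂ))}
    (hμ : μ ∈ perturbedGibbsMeasuresS (d := d) (fundamentalRep (Fin N)) (N * β) W)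
    {F : LGConfig d (Matrix.specialUnitaryGroup (Fin N) ℂ) → ℝ} (hFm : Measurable F) {ΛF : Finset (ZdEdge d)}
    (hFdep : DependsOn F (↑ΛF : Set (ZdEdge d))) {MF : ℝ} (hMF : ∀ σ, |F σ| ≤ MF) {δF : ZdEdge d → ℝ} (hδF : IsLipBound suFrobDist F δF)
    (hVm : ∀ X, Measurable (V X)) (hVdep : ∀ X, DependsOn (V X) (↑X : Set (ZdEdge d))) (hVb : ∀ X, ∃ C, ∀ U, |V X U| ≤ C)
    {lipV : Finset (ZdEdge d) → ZdEdge d → ℝ} (hlipV : ∀ X, IsLipBound suFrobDist (V X) (lipV X)) {L L₂ : ℝ}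
    (hLs : ∀ e, Summable fun X : Finset (ZdEdge d) => (if e ∈ X then ∑ y ∈ X, lipV X y else 0))
    (hL : ∀ e, ∑' X : Finset (ZdEdge d), (if e ∈ X then ∑ y ∈ X, lipV X y else 0) ≤ L)
    (hL2s : ∀ e, Summable fun X : Finset (ZdEdge d) => (if e ∈ X then X.card * ∑ y ∈ X, lipV X y else 0))
    (hL2 : ∀ e, ∑' X : Finset (ZdEdge d), (if e ∈ X then X.card * ∑ y ∈ X, lipV X y else 0) ≤ L₂)
    (hV'm : ∀ X, Measurable (V' X)) (hV'dep : ∀ X, DependsOn (V' X) (↑X : Set (ZdEdge d))) (hV'b : ∀ X, ∃ C, ∀ U, |V' X U| ≤ C)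
    {lipV' : Finset (ZdEdge d) → ZdEdge d → ℝ} (hlipV' : ∀ X, IsLipBound suFrobDist (V' X) (lipV' X)) {L' L₂' : ℝ}
    (hL's : ∀ e, Summable fun X : Finset (ZdEdge d) => (if e ∈ X then ∑ y ∈ X, lipV' X y else 0))
    (hL' : ∀ e, ∑' X : Finset (ZdEdge d), (if e ∈ X then ∑ y ∈ X, lipV' X y else 0) ≤ L')
    (hL2's : ∀ e, Summable fun X : Finset (ZdEdge d) => (if e ∈ X then X.card * ∑ y ∈ X, lipV' X y else 0))
    (hL2' : ∀ e, ∑' X : Finset (ZdEdge d), (if e ∈ X then X.card * ∑ y ∈ X, lipV' X y else 0) ≤ L₂') :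
    Summable (fun p : Finset (ZdEdge d) × Finset (ZdEdge d) =>
        |cov[fun σ => F σ * V p.1 σ, V' p.2; μ] - (∫ σ, F σ ∂μ) * cov[V p.1, V' p.2; μ] - (∫ σ, V p.1 σ ∂μ) * cov[F, V' p.2; μ]|) ∧
      ∑' p : Finset (ZdEdge d) × Finset (ZdEdge d),
          |cov[fun σ => F σ * V p.1 σ, V' p.2; μ] - (∫ σ, F σ ∂μ) * cov[V p.1, V' p.2; μ] - (∫ σ, V p.1 σ ∂μ) * cov[F, V' p.2; μ]| ≤
        768 * N * Real.sqrt N * (∑ y ∈ ΛF, δF y) *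
          (ΛF.card * (d * ((1 + exp (-(t / 3 / d))) / (1 - exp (-(t / 3 / d)))) ^ d)) *
          (L * L' * (ΛF.card * (d * ((1 + exp (-(t / 3 / d))) / (1 - exp (-(t / 3 / d)))) ^ d)) +
            L' * L₂ * (d * ((1 + exp (-(t / 3 / d))) / (1 - exp (-(t / 3 / d)))) ^ d) +
            L * L₂' * (d * ((1 + exp (-(t / 3 / d))) / (1 - exp (-(t / 3 / d)))) ^ d)) := by
  classical
  -- every finite set of pairs sits inside a product of its projections
  have hpartial : ∀ S : Finset (Finset (ZdEdge d) × Finset (ZdEdge d)), ∑ p ∈ S,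
      |cov[fun σ => F σ * V p.1 σ, V' p.2; μ] - (∫ σ, F σ ∂μ) * cov[V p.1, V' p.2; μ] - (∫ σ, V p.1 σ ∂μ) * cov[F, V' p.2; μ]| ≤
      768 * N * Real.sqrt N * (∑ y ∈ ΛF, δF y) *
          (ΛF.card * (d * ((1 + exp (-(t / 3 / d))) / (1 - exp (-(t / 3 / d)))) ^ d)) *
          (L * L' * (ΛF.card * (d * ((1 + exp (-(t / 3 / d))) / (1 - exp (-(t / 3 / d)))) ^ d)) +
            L' * L₂ * (d * ((1 + exp (-(t / 3 / d))) / (1 - exp (-(t / 3 / d)))) ^ d) +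
            L * L₂' * (d * ((1 + exp (-(t / 3 / d))) / (1 - exp (-(t / 3 / d)))) ^ d)) := by
    intro S
    have hsub : S ⊆ S.image Prod.fst ×ˢ S.image Prod.snd := fun p hp =>
      Finset.mem_product.2 ⟨Finset.mem_image_of_mem _ hp, Finset.mem_image_of_mem _ hp⟩
    refine (Finset.sum_le_sum_of_subset_of_nonneg hsub fun _ _ _ => abs_nonneg _).trans ?_
    rw [Finset.sum_product]
    exact sum_abs_threePoint_le_S hd hN hc hv hb hP hVB ht hρ hW hμ hFm hFdep hMF hδF hVm hVdep hVb hlipV hLs hL hL2s hL2 hV'm hV'dep hV'b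
      hlipV' hL's hL' hL2's hL2' _ _
  exact ⟨summable_of_sum_le (fun _ => abs_nonneg _) hpartial, Real.tsum_le_of_sum_le (fun _ => abs_nonneg _) hpartial⟩

end SUN

/-! ### `SU(2)`, `ℤ⁴`, hypothesis-free -/

/-- **`SU(2)`, `ℤ⁴` — FINITE SECOND-ORDER SUSCEPTIBILITY OF EVERY LIPSCHITZ CYLINDER AGAINST TWO DIRECTIONS OF FINITE (SIZE-WEIGHTED) LOAD,
uniformly on `MemBallZdS a Λ t`.**  `0 < t`, `6|β_W| e^{a} e^{t} + e^{a/2} √(2/3) Λ < 1` ⇒ for every member `W` (bare coupling `β_W/2`), EVERY DLR `μ`, every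
Lipschitz cylinder `F` and every two directions `V`, `V'` (measurable bounded own-link terms, Lipschitz witnesses of total loads `≤ L, L'` and
size-weighted loads `≤ L₂, L₂'` through every link): `(X, Y) ↦ |u₃(F; V_X; V'_Y)|` is summable over all pairs and
`Σ' |u₃| ≤ 1536√2 (#Λ_F K_F) (#Λ_F C) (L L' #Λ_F C + L' L₂ C + L L₂' C)`, `C = 4((1+e^{−t/12})/(1−e^{−t/12}))⁴`. -/
theorem su2_summable_abs_threePoint_direction_dim4 {βW a Λ t : ℝ} (ht : 0 < t)
    (hρ : 6 * |βW| * (exp a * exp t) + exp (a / 2) * Real.sqrt (2 / 3) * Λ < 1)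
    {W V V' : Potential (ZdEdge 4) (Matrix.specialUnitaryGroup (Fin 2) ℂ)} (hW : MemBallZdS a Λ t W)
    {μ : Measure (LGConfig 4 (Matrix.specialUnitaryGroup (Fin 2) ℂ))}
    (hμ : μ ∈ perturbedGibbsMeasuresS (d := 4) (fundamentalRep (Fin 2)) (2 * (βW / 4)) W)
    {F : LGConfig 4 (Matrix.specialUnitaryGroup (Fin 2) ℂ) → ℝ} {ΛF : Finset (ZdEdge 4)} {KF : ℝ≥0}
    (hF : IsLipschitzCylinder (fundamentalRep (Fin 2)) F ΛF KF)
    (hVm : ∀ X, Measurable (V X)) (hVdep : ∀ X, DependsOn (V X) (↑X : Set (ZdEdge 4))) (hVb : ∀ X, ∃ C, ∀ U, |V X U| ≤ C)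
    {lipV : Finset (ZdEdge 4) → ZdEdge 4 → ℝ} (hlipV : ∀ X, IsLipBound suFrobDist (V X) (lipV X)) {L L₂ : ℝ}
    (hLs : ∀ e, Summable fun X : Finset (ZdEdge 4) => (if e ∈ X then ∑ y ∈ X, lipV X y else 0))
    (hL : ∀ e, ∑' X : Finset (ZdEdge 4), (if e ∈ X then ∑ y ∈ X, lipV X y else 0) ≤ L)
    (hL2s : ∀ e, Summable fun X : Finset (ZdEdge 4) => (if e ∈ X then X.card * ∑ y ∈ X, lipV X y else 0))
    (hL2 : ∀ e, ∑' X : Finset (ZdEdge 4), (if e ∈ X then X.card * ∑ y ∈ X, lipV X y else 0) ≤ L₂)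
    (hV'm : ∀ X, Measurable (V' X)) (hV'dep : ∀ X, DependsOn (V' X) (↑X : Set (ZdEdge 4))) (hV'b : ∀ X, ∃ C, ∀ U, |V' X U| ≤ C)
    {lipV' : Finset (ZdEdge 4) → ZdEdge 4 → ℝ} (hlipV' : ∀ X, IsLipBound suFrobDist (V' X) (lipV' X)) {L' L₂' : ℝ}
    (hL's : ∀ e, Summable fun X : Finset (ZdEdge 4) => (if e ∈ X then ∑ y ∈ X, lipV' X y else 0))
    (hL' : ∀ e, ∑' X : Finset (ZdEdge 4), (if e ∈ X then ∑ y ∈ X, lipV' X y else 0) ≤ L')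
    (hL2's : ∀ e, Summable fun X : Finset (ZdEdge 4) => (if e ∈ X then X.card * ∑ y ∈ X, lipV' X y else 0))
    (hL2' : ∀ e, ∑' X : Finset (ZdEdge 4), (if e ∈ X then X.card * ∑ y ∈ X, lipV' X y else 0) ≤ L₂') :
    Summable (fun p : Finset (ZdEdge 4) × Finset (ZdEdge 4) =>
        |cov[fun σ => F σ * V p.1 σ, V' p.2; μ] - (∫ σ, F σ ∂μ) * cov[V p.1, V' p.2; μ] - (∫ σ, V p.1 σ ∂μ) * cov[F, V' p.2; μ]|) ∧
      ∑' p : Finset (ZdEdge 4) × Finset (ZdEdge 4),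
          |cov[fun σ => F σ * V p.1 σ, V' p.2; μ] - (∫ σ, F σ ∂μ) * cov[V p.1, V' p.2; μ] - (∫ σ, V p.1 σ ∂μ) * cov[F, V' p.2; μ]| ≤
        1536 * Real.sqrt 2 * (ΛF.card * KF) * (ΛF.card * (4 * ((1 + exp (-(t / 12))) / (1 - exp (-(t / 12)))) ^ 4)) *
          (L * L' * (ΛF.card * (4 * ((1 + exp (-(t / 12))) / (1 - exp (-(t / 12)))) ^ 4)) +
            L' * L₂ * (4 * ((1 + exp (-(t / 12))) / (1 - exp (-(t / 12)))) ^ 4) +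
            L * L₂' * (4 * ((1 + exp (-(t / 12))) / (1 - exp (-(t / 12)))) ^ 4)) := by
  classical
  have hc : (0 : ℝ) ≤ 2 / 3 := by norm_num
  have hP : ∀ B : Matrix (Fin 2) (Fin 2) ℂ, matrixOpNorm B ≤ |βW / 4| * (2 * (((4 : ℕ) : ℝ) - 1)) →
      ∀ (ψ : Matrix.specialUnitaryGroup (Fin 2) ℂ → ℝ) (M : ℝ), 0 ≤ M →
        (∀ x y, |ψ x - ψ y| ≤ M * suFrobDist x y) →
        Var[ψ; (haarProbability (Matrix.specialUnitaryGroup (Fin 2) ℂ)).tilted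
          fun g => ((2 : ℕ) : ℝ) * ((g : Matrix (Fin 2) (Fin 2) ℂ) * B).trace.re] ≤ 2 / 3 * M ^ 2 :=
    fun B hB ψ M hM hψ => oneLinkPoincareSUN_two_sharp _ B hB ψ M hM hψ
  have hVB := linVariance_of_poincare (N := 2) hP
  have hv : (0 : ℝ) ≤ 2 / 3 * ((2 : ℕ) : ℝ) ^ 2 := by norm_num
  have hsq : Real.sqrt (2 / 3 * (2 / 3 * ((2 : ℕ) : ℝ) ^ 2)) = 4 / 3 := by
    rw [show (2 / 3 * (2 / 3 * ((2 : ℕ) : ℝ) ^ 2) : ℝ) = (4 / 3) ^ 2 by norm_num, Real.sqrt_sq (by norm_num)]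
  have hρ' : 6 * (((4 : ℕ) : ℝ) - 1) * |βW / 4| * (exp a * exp t * Real.sqrt (2 / 3 * (2 / 3 * ((2 : ℕ) : ℝ) ^ 2))) +
      exp (a / 2) * Real.sqrt (2 / 3) * Λ < 1 := by
    rw [hsq, abs_div, abs_of_pos (by norm_num : (0 : ℝ) < 4)]
    have : 6 * (((4 : ℕ) : ℝ) - 1) * (|βW| / 4) * (exp a * exp t * (4 / 3)) = 6 * |βW| * (exp a * exp t) := by norm_num; ring
    rw [this]; exact hρ
  have hμ' : μ ∈ perturbedGibbsMeasuresS (d := 4) (fundamentalRep (Fin 2)) ((2 : ℕ) * (βW / 4)) W := by simpa using hμ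
  have hA : ∀ a b : Matrix.specialUnitaryGroup (Fin 2) ℂ, dist (suEntries a) (suEntries b) ≤ 1 * suFrobDist a b :=
    fun a b => by rw [one_mul]; exact dist_suEntries_le_suFrobDist a b
  have key := summable_abs_threePoint_direction_S (N := 2) (d := 4) (by norm_num) (by norm_num) hc hv le_rfl hP hVB ht hρ' hW hμ' hF.measurable
    hF.dependsOn hF.abs_le (hF.isLipBound zero_le_one hA) hVm hVdep hVb hlipV hLs hL hL2s hL2 hV'm hV'dep hV'b hlipV' hL's hL' hL2's hL2'
  refine ⟨key.1, key.2.trans (le_of_eq ?_)⟩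
  have hsumF : ∑ y ∈ ΛF, (if y ∈ ΛF then (1 : ℝ) * (KF : ℝ) else 0) = ΛF.card * KF := by
    rw [Finset.sum_congr rfl fun y hy => by rw [if_pos hy, one_mul], Finset.sum_const, nsmul_eq_mul]
  have h2 : Real.sqrt ((2 : ℕ) : ℝ) = Real.sqrt 2 := by norm_num
  rw [hsumF, h2, show (t / 3 / ((4 : ℕ) : ℝ)) = t / 12 by push_cast; ring]
  norm_num

end Summit.Ventures.YMGap.RobustBall

end
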